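import Mathlib.FieldTheory.Galois.Infinite
import Mathlib.FieldTheory.IsAlgClosed.AlgebraicClosure
import Mathlib.FieldTheory.Minpoly.Finite
import Mathlib.NumberTheory.NumberField.Basic
import Mathlib.RingTheory.Polynomial.Cyclotomic.Roots
import Mathlib.RingTheory.RootsOfUnity.AlgebraicallyClosed
import HarnessLib

/-!
# A number field is not algebraically closed; its absolute Galois group moves every non-rational element

Topic `Literature/NumberTheory/NumberFields`.  Theorem-only file (no definition, no named fact),
classical, unconditional; Mathlib vocabulary (`NumberField`, `IsAlgClosed`, `IsAlgClosure`,
`IsPrimitiveRoot`, `minpoly`, `L ≃ₐ[F] L`).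

**Theorem.**  Let `F` be a number field.

* `natDegree_minpoly_eq_of_isPrimitiveRoot`: a primitive `q`-th root of unity in `F` (`q` prime) has
  minimal polynomial `Φ_q` over `ℚ`, of degree `q - 1` — which is `≤ [F:ℚ]`, so `F` contains NO primitive
  `q`-th root of unity once `q > [F:ℚ] + 1` (that `F`-level statement is already in the tree as
  `Literature.IUT.HodgeTheaters.not_isPrimitiveRoot_of_finrank_lt`, in a file far higher in the import
  graph; it is re-derived inline below, not restated);
* `exists_not_mem_range_algebraMap`: an algebraically closed field `L ⊇ F` contains an element outside
  `F` (a primitive `q`-th root of unity, `q > [F:ℚ] + 1` prime);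
* `not_surjective_algebraMap`, `not_isAlgClosed`: in particular `F ↪ L` is not onto and `F` itself is
  not algebraically closed;
* `exists_algEquiv_apply_ne_of_not_mem_range` / `exists_algEquiv_apply_ne`: for an ALGEBRAIC CLOSURE
  `L = F̄` (Galois over `F`: characteristic `0`), every `c ∈ F̄ ∖ F` is moved by some `σ ∈ Gal(F̄/F)`;
  hence `Gal(F̄/F)` acts non-trivially on `F̄`: `∃ σ c, σ c ≠ c` (equivalently `Gal(F̄/F) ≠ 1`).

Proof: `[ℚ(ζ_q):ℚ] = φ(q) = q - 1` (irreducibility of `Φ_q` over `ℚ`, Mathlib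
`Polynomial.cyclotomic_eq_minpoly_rat`) against `deg minpoly_ℚ(a) ≤ [F:ℚ]` (`minpoly.natDegree_le`);
the Galois step is the (infinite) Galois correspondence `F̄^{Gal(F̄/F)} = F`
(Mathlib `InfiniteGalois.mem_range_algebraMap_iff_fixed`).

Used by the abc-iut cell (GAP B, [IUTchI] Ex. 5.4 (iv)) to discharge the hypothesis
"`G_F` moves one constant of `F̄`" (`∃ (σ : F̄ ≃ₐ[F] F̄) (c : F̄), σ c ≠ c`) of the non-vacuity lemmas at an
initial Θ-datum; nothing in this file depends on or asserts anything from that corpus.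

## References

* S. Lang, *Algebra*, rev. 3rd ed. (2002), Ch. VI §3, Thm. 3.1 (`[ℚ(ζ_n):ℚ] = φ(n)`), Ch. VI §1 (Galois
  correspondence, fixed field of the full group).
* J. Neukirch, *Algebraic Number Theory* (1999), Ch. I §2 (number fields are finite over `ℚ`), Ch. I §10
  (cyclotomic fields).
-/

namespace Literature.NumberTheory.NumberFields

open Polynomial

section Cyclotomic

variable {F : Type*} [Field F] [NumberField F]

/-- The minimal polynomial over `ℚ` of a primitive `q`-th root of unity (`q` prime) lying in a number
field `F` is the cyclotomic polynomial `Φ_q`, of degree `q - 1`. [cite: Lang2002, Ch. VI §3 Thm. 3.1] -/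
theorem natDegree_minpoly_eq_of_isPrimitiveRoot {q : ℕ} (hq : q.Prime) {a : F} (ha : IsPrimitiveRoot a q) :
    (minpoly ℚ a).natDegree = q - 1 := by
  rw [← Polynomial.cyclotomic_eq_minpoly_rat ha hq.pos, Polynomial.natDegree_cyclotomic,
    Nat.totient_prime hq]

end Cyclotomic

section AlgClosed

variable (F L : Type*) [Field F] [NumberField F] [Field L] [Algebra F L]

/-- **An algebraically closed field over a number field `F` has an element outside `F`**: a primitive
`q`-th root of unity `ζ_q ∈ L`, `q > [F:ℚ] + 1` prime, is not in the image of `F`.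
[cite: Lang2002, Ch. VI §3 Thm. 3.1] -/
theorem exists_not_mem_range_algebraMap [IsAlgClosed L] : ∃ c : L, c ∉ Set.range (algebraMap F L) := by
  haveI : CharZero L := charZero_of_injective_algebraMap (algebraMap F L).injective
  obtain ⟨q, hle, hq⟩ := Nat.exists_infinite_primes (Module.finrank ℚ F + 2)
  haveI : NeZero q := ⟨hq.ne_zero⟩
  obtain ⟨ζ, hζ⟩ := HasEnoughRootsOfUnity.exists_primitiveRoot L q
  refine ⟨ζ, ?_⟩
  rintro ⟨a, rfl⟩
  -- `a` is a primitive `q`-th root of unity in `F`: `deg minpoly_ℚ(a) = q - 1 ≤ [F:ℚ] < q - 1`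
  have ha : IsPrimitiveRoot a q :=
    hζ.of_map_of_injective (f := algebraMap F L) (algebraMap F L).injective
  have h1 := natDegree_minpoly_eq_of_isPrimitiveRoot hq ha
  have h2 : (minpoly ℚ a).natDegree ≤ Module.finrank ℚ F := minpoly.natDegree_le a
  omega

/-- The structure map `F → L` of an algebraically closed field over a number field is not surjective.
[cite: Lang2002, Ch. VI §3 Thm. 3.1] -/
theorem not_surjective_algebraMap [IsAlgClosed L] : ¬ Function.Surjective (algebraMap F L) := by
  intro h
  obtain ⟨c, hc⟩ := exists_not_mem_range_algebraMap F L
  exact hc (h c)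

/-- **A number field is not algebraically closed.** [cite: Lang2002, Ch. VI §3 Thm. 3.1] -/
theorem not_isAlgClosed : ¬ IsAlgClosed F := by
  intro h
  exact not_surjective_algebraMap F F Function.surjective_id

/-- `F̄/F` is Galois for an algebraic closure `F̄` of a number field `F` (characteristic zero: separable;
an algebraic closure is normal). [cite: Lang2002, Ch. VI §1] -/
theorem isGalois_of_isAlgClosure [IsAlgClosure F L] : IsGalois F L :=
  isGalois_iff.mpr ⟨inferInstance, inferInstance⟩

/-- **Every element of `F̄ ∖ F` is moved by the absolute Galois group**: for an algebraic closure `L = F̄`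
of the number field `F` and `c ∈ F̄` not in `F`, some `σ ∈ Gal(F̄/F)` has `σ c ≠ c` (the fixed field of
`Gal(F̄/F)` is `F`; infinite Galois correspondence). [cite: Lang2002, Ch. VI §1] -/
theorem exists_algEquiv_apply_ne_of_not_mem_range [IsAlgClosure F L] {c : L}
    (hc : c ∉ Set.range (algebraMap F L)) : ∃ σ : L ≃ₐ[F] L, σ c ≠ c := by
  haveI := isGalois_of_isAlgClosure F L
  by_contra h
  push Not at h
  exact hc ((InfiniteGalois.mem_range_algebraMap_iff_fixed c).mpr h)

/-- **The absolute Galois group of a number field acts non-trivially on `F̄`**: `∃ σ ∈ Gal(F̄/F)` and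
`c ∈ F̄` with `σ c ≠ c` (so `Gal(F̄/F) ≠ 1`), for any algebraic closure `L = F̄` of the number field `F`.
[cite: Lang2002, Ch. VI §1] -/
theorem exists_algEquiv_apply_ne [IsAlgClosure F L] : ∃ (σ : L ≃ₐ[F] L) (c : L), σ c ≠ c := by
  haveI : IsAlgClosed L := IsAlgClosure.isAlgClosed F
  obtain ⟨c, hc⟩ := exists_not_mem_range_algebraMap F L
  obtain ⟨σ, hσ⟩ := exists_algEquiv_apply_ne_of_not_mem_range F L hc
  exact ⟨σ, c, hσ⟩

/-- Equivalently: `Gal(F̄/F)` is not the trivial group. [cite: Lang2002, Ch. VI §1] -/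
theorem exists_algEquiv_ne_one [IsAlgClosure F L] : ∃ σ : L ≃ₐ[F] L, σ ≠ 1 := by
  obtain ⟨σ, c, hσ⟩ := exists_algEquiv_apply_ne F L
  exact ⟨σ, fun h => hσ (by rw [h]; rfl)⟩

end AlgClosed

end Literature.NumberTheory.NumberFields
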